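import Summits.QuantumFields.YangMills.Theorems.ConvexGribovBodyCovarianceBoundMomentumSplit
import Summits.QuantumFields.YangMills.Theorems.ConvexGribovBodyCovarianceBoundStubConeInequality
import Summits.QuantumFields.YangMills.Theorems.ConvexGribovBodyCovarianceBoundStubLieProjControl
import Summits.QuantumFields.YangMills.Theorems.ConvexGribovBodyCovarianceBoundStubTwistGapMeasurable
import HarnessLib

/-!
# `CovarianceBound` at zero momentum reduced to the mean TWIST GAP of the minimal Coulomb gauge
# (crux stmt-QuantumFields-8780, line `Sketch` = ideator-4 `twist-stiffness-envelope`, continuation lead c4)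

Route `QuantumFields/YangMills/ConvexGribovBody`, crux
`Summit.QuantumFields.YangMills.Theses.ConvexGribovBody.CovarianceBound`.

The three deterministic stubs of the skeleton `Cruxes/CovarianceBound/Lines/Sketch.lean` have landed:
* `stub_coneInequality` (p138191): at an absolute Coulomb minimiser, for every one-parameter generator `X ∈ 𝔤`,
  `zeroModePair² ≤ 2 (L³ ‖X‖²_F) · twistGap` (boost = twisted quasi-periodic gauge transformation + second-order Taylor);
* `stub_lieProjControl` (p137962): finitely many carrier directions control `‖P_𝔤 ·‖²_F`;
* `stub_twistGapMeasurable` (p137844): `twistGap` is a Borel function of the configuration with `0 ≤ twistGap ≤ 6 N L³`.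

This file composes them into two UNCONDITIONAL theorems and one conditional reduction:
* `exists_supLieCosSq_zero_le` — **configuration-wise, the zero-momentum `𝔤`-mode integrand of the crux is bounded by the
  twist gap**: `sup_{h ∈ argmin} ‖P_𝔤 Ĉ_j(0)‖²_F ≤ C_r (2S+1)³ · twistGap_j(U)` for every `U` (no measure, no minimality
  hypothesis left: the sup is over the argmin);
* `integral_supLieCosSq_zero_le` — integrated against the Wilson measure: `∫ sup ‖P_𝔤 Ĉ_j(0)‖² ≤ C_r L³ ∫ twistGap_j`;
* `lieModeBoundZero_of_meanTwistGapBound` (registered glue) — the route-posited, OPEN measure-side statement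
  `MeanTwistGapBound` (the Wilson average of the twist gap is bounded uniformly in the volume at `β ≥ β₀`: the defect
  energy of the "Coulomb gauge glass" is `O(1)`) implies `LieModeBoundZero`, the `p = 0` piece of the crux's `𝔤`-half
  (`…MomentumSplit`); with the landed trichotomy, `covarianceBound_of_meanTwistGap_pos_perp :
  MeanTwistGapBound → LieModeBoundPos → PerpModeBound → CovarianceBound`.

So the `p = 0` corner of the crux is CLOSED MODULO a statement of a different type (a mean defect ENERGY of the gauge-fixing
functional instead of a second moment of an argmin Fourier mode). Nothing here closes the crux: `LieModeBoundPos` (all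
`p ≠ 0`) is the Gribov–Zwanziger infrared problem proper and `MeanTwistGapBound` is open (numerically true at β = 0, L ≤ 13;
undecided at weak coupling — kit jobs j021970/j021971 of this seat test its trend in `L`).

Design as in `…MomentReduction` / `…MomentumSplit`: `MeanTwistGapBound` is a route-posited `def … : Prop` (not a literature
fact: nothing in print bounds it for any non-abelian `G`), the reduction theorems are conditional on it and credit nothing.
References: idea card `Cruxes/CovarianceBound/Ideas/twist-stiffness-envelope.md`; J. M. Kosterlitz, N. Akino,
cond-mat/9806346 (boundary-condition-optimised defect energies of gauge glasses); D. Zwanziger, Nucl. Phys. B 412 (1994) 657.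
-/

set_option autoImplicit false

noncomputable section

namespace Summit.QuantumFields.YangMills.Cruxes.CovarianceBound.TwistStiffness

open scoped BigOperators Matrix ComplexConjugate
open MeasureTheory Literature.MathematicalPhysics.QuantumFieldTheory
open Summit.QuantumFields.YangMills.Cruxes.CovarianceBound.SupportWindow

variable {G : Type} [Group G] [TopologicalSpace G]

/-! ### The route-posited measure-side statement -/

/-- **Mean twist-gap bound** (route-posited, OPEN; the transfer `C⁺` of the line `Sketch` / idea card
`twist-stiffness-envelope`): for every compact simple `G` and faithful unitary `r` there is `β₀` such that for `β ≥ β₀`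
there are `D > 0`, `S₀` with: on every torus `(2S+1)⁴`, `S ≥ S₀`, for every spatial direction `j`,
`∫ twistGap r S j U dμ_β(U) ≤ D` — the drop of the minimal slice Coulomb energy when the gauge transformation may be twisted
around the `j`-cycle is bounded IN MEAN uniformly in the volume ("the periodic sector of the Coulomb gauge glass is unfrustrated
to `O(1)`"; stiffness exponent `θ_s ≤ 0` in b.c.-optimised defect-energy language). Kinematically `twistGap ≤ 6 N L³`; on the
spread toron it is `≍ L`. -/
def MeanTwistGapBound : Prop :=
  ∀ (G : Type) [Group G] [TopologicalSpace G] [IsTopologicalGroup G] [CompactSpace G]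
    [MeasurableSpace G] [BorelSpace G], IsCompactSimpleLieGroup G → ∀ r : LatticeRep G,
    ∃ β₀ : ℝ, ∀ β : ℝ, β₀ ≤ β → ∃ D : ℝ, 0 < D ∧ ∃ S₀ : ℕ, ∀ S : ℕ, S₀ ≤ S →
      ∀ j : Fin 3, ∫ U, twistGap r S j U ∂(wilson4 r β S) ≤ D

/-! ### Unconditional consequences of the three landed stubs -/

/-- At `p = 0` the mid-link cosine mode is the plain zero mode `Σ_y A_j(y)`. [folklore] -/
theorem cosMode_zero (r : LatticeRep G) (S : ℕ) (j : Fin 3) (U : GaugeConfig 4 (2 * S + 1) G)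
    (h : Site 4 (2 * S + 1) → G) :
    cosMode r S 0 j U h = ∑ y : Fin 3 → ZMod (2 * S + 1), gluon r S U h y j := by
  unfold cosMode
  simp

/-- **The zero-momentum `𝔤`-mode is bounded by the twist gap, configuration-wise.** For every faithful unitary `r` there is
`C ≥ 0` with `sup_{h ∈ argmin coul(U,·)} ‖P_𝔤 Ĉ_j(0; U, h)‖²_F ≤ C (2S+1)³ · twistGap r S j U` for all `S`, `j`, `U`
(cone inequality along every carrier direction + finite-dimensional control of the `𝔤`-projection). -/
theorem exists_supLieCosSq_zero_le [IsTopologicalGroup G] [CompactSpace G] [MeasurableSpace G] [BorelSpace G]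
    (r : LatticeRep G) :
    ∃ C : ℝ, 0 ≤ C ∧ ∀ (S : ℕ) (j : Fin 3) (U : GaugeConfig 4 (2 * S + 1) G),
      supLieCosSq r S 0 j U ≤ C * (2 * S + 1 : ℝ) ^ 3 * twistGap r S j U := by
  obtain ⟨C, hC0, hCb⟩ := stub_lieProjControl r
  refine ⟨2 * C, by positivity, fun S j U => ?_⟩
  have hgap : 0 ≤ twistGap r S j U := ((stub_twistGapMeasurable r S j).2 U).1
  have hb : 0 ≤ 2 * (2 * S + 1 : ℝ) ^ 3 * twistGap r S j U := by positivity
  have hbound : ∀ hh : {h : Site 4 (2 * S + 1) → G // IsCoulMin r S U h},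
      froSq (lieCosMode r S 0 j U hh.1) ≤ C * (2 * (2 * S + 1 : ℝ) ^ 3 * twistGap r S j U) := fun hh => by
    obtain ⟨h, hmin⟩ := hh
    change froSq (r.lieProj (cosMode r S 0 j U h)) ≤ _
    rw [cosMode_zero]
    refine hCb _ _ hb fun X hX => ?_
    have hcone := stub_coneInequality r S j X hX U h hmin
    have hz : zeroModePair r S j U h X =
        -(((∑ y : Fin 3 → ZMod (2 * S + 1), gluon r S U h y j) * X).trace.re) := rfl
    rw [hz, neg_sq] at hcone
    calc ((∑ y : Fin 3 → ZMod (2 * S + 1), gluon r S U h y j) * X).trace.re ^ 2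
        ≤ 2 * ((2 * S + 1 : ℝ) ^ 3 * froSq X) * twistGap r S j U := hcone
      _ = 2 * (2 * S + 1 : ℝ) ^ 3 * twistGap r S j U * froSq X := by ring
  calc supLieCosSq r S 0 j U ≤ C * (2 * (2 * S + 1 : ℝ) ^ 3 * twistGap r S j U) :=
        Real.iSup_le hbound (mul_nonneg hC0 hb)
    _ = 2 * C * (2 * S + 1 : ℝ) ^ 3 * twistGap r S j U := by ring

/-- **Integrated form**: `∫ sup ‖P_𝔤 Ĉ_j(0)‖²_F dμ_β ≤ C_r (2S+1)³ ∫ twistGap_j dμ_β` for every `β`, `S`, `j`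
(both integrands are bounded Borel functions on the Wilson probability space). -/
theorem integral_supLieCosSq_zero_le [IsTopologicalGroup G] [CompactSpace G] [MeasurableSpace G] [BorelSpace G]
    (r : LatticeRep G) :
    ∃ C : ℝ, 0 ≤ C ∧ ∀ (β : ℝ) (S : ℕ) (j : Fin 3),
      ∫ U, supLieCosSq r S 0 j U ∂(wilson4 r β S) ≤
        C * (2 * S + 1 : ℝ) ^ 3 * ∫ U, twistGap r S j U ∂(wilson4 r β S) := by
  obtain ⟨C, hC0, hC⟩ := exists_supLieCosSq_zero_le (G := G) r
  refine ⟨C, hC0, fun β S j => ?_⟩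
  have hM := stub_supMeasurable G r S 0 j
  have hP := stub_projSplit G r S 0 j
  have hcosb : ∀ (U : GaugeConfig 4 (2 * S + 1) G) (h : Site 4 (2 * S + 1) → G),
      IsCoulMin r S U h → froSq (cosMode r S 0 j U h) ≤ r.N * (2 * S + 1 : ℝ) ^ 6 :=
    fun U h _ => (hM.2.1 U h).2.1
  have hbL : ∀ U, 0 ≤ supLieCosSq r S 0 j U ∧ supLieCosSq r S 0 j U ≤ r.N * (2 * S + 1 : ℝ) ^ 6 :=
    fun U => ⟨(hP.2.2.2 U (hcosb U)).1, (hP.2.2.2 U (hcosb U)).2.1⟩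
  have hintL : Integrable (supLieCosSq r S 0 j) (wilson4 r β S) :=
    Integrable.of_mem_Icc 0 (r.N * (2 * S + 1 : ℝ) ^ 6) (hP.2.1).aemeasurable
      (ae_of_all _ fun U => ⟨(hbL U).1, (hbL U).2⟩)
  have hT := stub_twistGapMeasurable r S j
  have hintT : Integrable (twistGap r S j) (wilson4 r β S) :=
    Integrable.of_mem_Icc 0 (6 * r.N * (2 * S + 1 : ℝ) ^ 3) hT.1.aemeasurable
      (ae_of_all _ fun U => ⟨(hT.2 U).1, (hT.2 U).2⟩)
  calc ∫ U, supLieCosSq r S 0 j U ∂(wilson4 r β S)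
      ≤ ∫ U, C * (2 * S + 1 : ℝ) ^ 3 * twistGap r S j U ∂(wilson4 r β S) :=
        integral_mono hintL (hintT.const_mul _) fun U => hC S j U
    _ = C * (2 * S + 1 : ℝ) ^ 3 * ∫ U, twistGap r S j U ∂(wilson4 r β S) := integral_const_mul _ _

/-! ### The reduction of the `p = 0` corner, and its place in the crux -/

/-- **`MeanTwistGapBound → LieModeBoundZero`** (registered glue of the line `Sketch`): a volume-uniform bound on the mean
twist gap gives the `p = 0` piece of the crux's `𝔤`-half, with `D' = C_r D + 1`. -/
theorem lieModeBoundZero_of_meanTwistGapBound : MeanTwistGapBound → LieModeBoundZero := by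
  intro hT G _ _ _ _ _ _ hG r
  obtain ⟨β₀, hβ₀⟩ := hT G hG r
  obtain ⟨C, hC0, hC⟩ := integral_supLieCosSq_zero_le (G := G) r
  refine ⟨β₀, fun β hβ => ?_⟩
  obtain ⟨D, hD0, S₀, hS₀⟩ := hβ₀ β hβ
  refine ⟨C * D + 1, by positivity, S₀, fun S hS j => ?_⟩
  have hL3 : (0 : ℝ) ≤ (2 * S + 1 : ℝ) ^ 3 := by positivity
  calc ∫ U, supLieCosSq r S 0 j U ∂(wilson4 r β S)
      ≤ C * (2 * S + 1 : ℝ) ^ 3 * ∫ U, twistGap r S j U ∂(wilson4 r β S) := hC β S j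
    _ ≤ C * (2 * S + 1 : ℝ) ^ 3 * D := mul_le_mul_of_nonneg_left (hS₀ S hS j) (by positivity)
    _ ≤ (C * D + 1) * (2 * S + 1 : ℝ) ^ 3 := by nlinarith [mul_nonneg hC0 hD0.le]

/-- **The crux from the mean twist-gap bound and its two remaining pieces**: `MeanTwistGapBound` (this line's open
transfer, `p = 0`), `LieModeBoundPos` (all `p ≠ 0`: Gribov–Zwanziger infrared finiteness proper) and `PerpModeBound`
(the `𝔤^⊥`-half) give `CovarianceBound` (landed trichotomy `covarianceBound_of_zero_pos_perp`). -/
theorem covarianceBound_of_meanTwistGap_pos_perp :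
    MeanTwistGapBound → LieModeBoundPos → PerpModeBound →
      Summit.QuantumFields.YangMills.Theses.ConvexGribovBody.CovarianceBound :=
  fun hT hP hQ => covarianceBound_of_zero_pos_perp (lieModeBoundZero_of_meanTwistGapBound hT) hP hQ

end Summit.QuantumFields.YangMills.Cruxes.CovarianceBound.TwistStiffness

end
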